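import Mathlib

/-!
# PneNP / OverlapGapAlgebra — crux `SolvableImpliesStableSection` (stmt-PneNP-2463):
# the UNIT CLAUSE block (2/·) — basic facts on the localized unit-clause dynamics

Support for crux `stmt-PneNP-2463` (`Summit.PneNP.PneNP.Theses.OverlapGapAlgebra.SolvableImpliesStableSection`),
registered stub `stub_lowDensity` (child G).  The dynamics (`…UnitClauseObjects`): `R` rounds; in
round `t` an unset variable carrying a non-muted unit clause is forced to the value demanded by its
least unit clause, an unset variable without unit clause is set `true` if its label window `⌊vR/n⌋` is
`t`; set variables never change.  This file: persistence and monotonicity of the states, every variable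
is set after its window (so all are set after `R ≥ 1` rounds), a forced variable takes the demanded
value, a clause is unit on at most one variable and in at most one round, a clause unit at round `t + 1`
has a slot that was set during round `t` ("newly unit"), and no clause is unit at round `0`.

All objects are hypotheses (`h0`, `hstep` of `sissU_exists_dyn`); no definitions; axioms `propext`,
`Classical.choice`, `Quot.sound`.
-/

set_option linter.dupNamespace false -- `Summit.PneNP.PneNP.…`: summit = sub-problem (D-0017)

namespace Summit.PneNP.PneNP.Theorems

open Finset
open scoped Classical

section Dynamics

variable {m k n : ℕ} {R : ℕ}
  (st : Finset (Fin m) → ℕ → (Fin m → Fin k → Fin n × Bool) → Fin n → Option Bool)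
  (dm : Finset (Fin m) → ℕ → (Fin m → Fin k → Fin n × Bool) → Fin n → Bool)
  (h0 : ∀ (S : Finset (Fin m)) (Φ : Fin m → Fin k → Fin n × Bool) (v : Fin n), st S 0 Φ v = none)
  (hstep : ∀ (S : Finset (Fin m)) (t : ℕ) (Φ : Fin m → Fin k → Fin n × Bool) (v : Fin n),
    st S (t + 1) Φ v =
      if st S t Φ v = none then
        (if ∃ i : Fin m, i ∉ S ∧ ∃ j : Fin k, (Φ i j).1 = v ∧ ∀ j' : Fin k, j' ≠ j →
            st S t Φ (Φ i j').1 ≠ none ∧ st S t Φ (Φ i j').1 ≠ some (Φ i j').2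
          then some (dm S t Φ v)
          else if (v : ℕ) * R / n = t then some true else none)
      else st S t Φ v)

include hstep in
/-- A set variable keeps its value in the next round. -/
theorem sissU_st_succ_of_eq_some (S : Finset (Fin m)) (t : ℕ) (Φ : Fin m → Fin k → Fin n × Bool)
    (v : Fin n) (b : Bool) (h : st S t Φ v = some b) : st S (t + 1) Φ v = some b := by
  rw [hstep, if_neg (by rw [h]; exact Option.some_ne_none b), h]

include hstep in
/-- A set variable keeps its value forever. -/
theorem sissU_st_mono (S : Finset (Fin m)) (Φ : Fin m → Fin k → Fin n × Bool) (v : Fin n) (b : Bool)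
    (t t' : ℕ) (htt' : t ≤ t') (h : st S t Φ v = some b) : st S t' Φ v = some b := by
  induction t' with
  | zero =>
    obtain rfl : t = 0 := Nat.le_zero.mp htt'
    exact h
  | succ t' ih =>
    rcases Nat.of_le_succ htt' with hle | rfl
    · exact sissU_st_succ_of_eq_some st dm hstep S t' Φ v b (ih hle)
    · exact h

include hstep in
/-- An unset variable was unset at every earlier round. -/
theorem sissU_st_none_anti (S : Finset (Fin m)) (Φ : Fin m → Fin k → Fin n × Bool) (v : Fin n)
    (t t' : ℕ) (htt' : t ≤ t') (h : st S t' Φ v = none) : st S t Φ v = none := by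
  by_contra hne
  obtain ⟨b, hb⟩ := Option.ne_none_iff_exists'.mp hne
  have := sissU_st_mono st dm hstep S Φ v b t t' htt' hb
  rw [h] at this
  exact Option.some_ne_none b this.symm

include hstep in
/-- Values are consistent across rounds: a variable set to `b` at round `t` and to `b'` at round `t'`
has `b = b'`. -/
theorem sissU_st_some_inj (S : Finset (Fin m)) (Φ : Fin m → Fin k → Fin n × Bool) (v : Fin n)
    (t t' : ℕ) (b b' : Bool) (h : st S t Φ v = some b) (h' : st S t' Φ v = some b') : b = b' := by
  rcases le_total t t' with hle | hle
  · have := sissU_st_mono st dm hstep S Φ v b t t' hle h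
    rw [h'] at this
    exact (Option.some_injective _ this).symm
  · have := sissU_st_mono st dm hstep S Φ v b' t' t hle h'
    rw [h] at this
    exact Option.some_injective _ this

include hstep in
/-- Every variable is set right after the round of its label window. -/
theorem sissU_st_window_succ (S : Finset (Fin m)) (Φ : Fin m → Fin k → Fin n × Bool) (v : Fin n)
    (t : ℕ) (ht : (v : ℕ) * R / n = t) : st S (t + 1) Φ v ≠ none := by
  rw [hstep]
  split_ifs with h1 h2 <;> first | exact Option.some_ne_none _ | exact h1

include hstep in
/-- Every variable is set at every round after its label window. -/
theorem sissU_st_ne_none_of_window_lt (S : Finset (Fin m)) (Φ : Fin m → Fin k → Fin n × Bool)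
    (v : Fin n) (t : ℕ) (ht : (v : ℕ) * R / n < t) : st S t Φ v ≠ none := by
  intro h
  have h1 := sissU_st_none_anti st dm hstep S Φ v ((v : ℕ) * R / n + 1) t ht h
  exact sissU_st_window_succ st dm hstep S Φ v _ rfl h1

include hstep in
/-- **After `R ≥ 1` rounds every variable is set.** (The window `⌊vR/n⌋` of `v < n` is `< R`.) -/
theorem sissU_st_R_ne_none (hR : 1 ≤ R) (S : Finset (Fin m)) (Φ : Fin m → Fin k → Fin n × Bool)
    (v : Fin n) (t : ℕ) (ht : R ≤ t) : st S t Φ v ≠ none := by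
  refine sissU_st_ne_none_of_window_lt st dm hstep S Φ v t (lt_of_lt_of_le ?_ ht)
  have hn : 0 < n := Fin.pos v
  exact Nat.div_lt_of_lt_mul (Nat.mul_lt_mul_of_pos_right v.isLt hR)

include hstep in
/-- **A forced variable takes the demanded value.** If `v` is unset at round `t` and some non-muted
clause is unit on `v`, then at round `t + 1` it is set to `dm S t Φ v`. -/
theorem sissU_st_forced (S : Finset (Fin m)) (t : ℕ) (Φ : Fin m → Fin k → Fin n × Bool) (v : Fin n)
    (hv : st S t Φ v = none)
    (hunit : ∃ i : Fin m, i ∉ S ∧ ∃ j : Fin k, (Φ i j).1 = v ∧ ∀ j' : Fin k, j' ≠ j →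
      st S t Φ (Φ i j').1 ≠ none ∧ st S t Φ (Φ i j').1 ≠ some (Φ i j').2) :
    st S (t + 1) Φ v = some (dm S t Φ v) := by
  rw [hstep, if_pos hv, if_pos hunit]

include hstep in
/-- **A free variable is set `true`.** If `v` is unset at round `t`, no non-muted clause is unit on `v`
and `t` is the label window of `v`, then `v` is set to `true`. -/
theorem sissU_st_free (S : Finset (Fin m)) (t : ℕ) (Φ : Fin m → Fin k → Fin n × Bool) (v : Fin n)
    (hv : st S t Φ v = none)
    (hnu : ¬ ∃ i : Fin m, i ∉ S ∧ ∃ j : Fin k, (Φ i j).1 = v ∧ ∀ j' : Fin k, j' ≠ j →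
      st S t Φ (Φ i j').1 ≠ none ∧ st S t Φ (Φ i j').1 ≠ some (Φ i j').2)
    (ht : (v : ℕ) * R / n = t) : st S (t + 1) Φ v = some true := by
  rw [hstep, if_pos hv, if_neg hnu, if_pos ht]

include hstep in
/-- **Otherwise an unset variable stays unset.** -/
theorem sissU_st_stay (S : Finset (Fin m)) (t : ℕ) (Φ : Fin m → Fin k → Fin n × Bool) (v : Fin n)
    (hv : st S t Φ v = none)
    (hnu : ¬ ∃ i : Fin m, i ∉ S ∧ ∃ j : Fin k, (Φ i j).1 = v ∧ ∀ j' : Fin k, j' ≠ j →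
      st S t Φ (Φ i j').1 ≠ none ∧ st S t Φ (Φ i j').1 ≠ some (Φ i j').2)
    (ht : (v : ℕ) * R / n ≠ t) : st S (t + 1) Φ v = none := by
  rw [hstep, if_pos hv, if_neg hnu, if_neg ht]

include hstep in
/-- **How a variable gets set.** If `v` is unset at round `t` and set at round `t + 1`, then either a
non-muted clause is unit on `v` at round `t` (forced) or `t` is the label window of `v` (free). -/
theorem sissU_forced_or_free (S : Finset (Fin m)) (t : ℕ) (Φ : Fin m → Fin k → Fin n × Bool)
    (v : Fin n) (hv : st S t Φ v = none) (hv' : st S (t + 1) Φ v ≠ none) :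
    (∃ i : Fin m, i ∉ S ∧ ∃ j : Fin k, (Φ i j).1 = v ∧ ∀ j' : Fin k, j' ≠ j →
      st S t Φ (Φ i j').1 ≠ none ∧ st S t Φ (Φ i j').1 ≠ some (Φ i j').2) ∨ (v : ℕ) * R / n = t := by
  by_cases h1 : ∃ i : Fin m, i ∉ S ∧ ∃ j : Fin k, (Φ i j).1 = v ∧ ∀ j' : Fin k, j' ≠ j →
      st S t Φ (Φ i j').1 ≠ none ∧ st S t Φ (Φ i j').1 ≠ some (Φ i j').2
  · exact Or.inl h1
  by_cases h2 : (v : ℕ) * R / n = t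
  · exact Or.inr h2
  exact absurd (sissU_st_stay st dm hstep S t Φ v hv h1 h2) hv'

/-- **A clause is unit on at most one variable** (its unique unset slot). -/
theorem sissU_unit_var_unique (S : Finset (Fin m)) (t : ℕ) (Φ : Fin m → Fin k → Fin n × Bool)
    (i : Fin m) (v v' : Fin n)
    (hu : ∃ j : Fin k, (Φ i j).1 = v ∧ st S t Φ v = none ∧ ∀ j' : Fin k, j' ≠ j →
      st S t Φ (Φ i j').1 ≠ none ∧ st S t Φ (Φ i j').1 ≠ some (Φ i j').2)
    (hu' : ∃ j : Fin k, (Φ i j).1 = v' ∧ st S t Φ v' = none ∧ ∀ j' : Fin k, j' ≠ j →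
      st S t Φ (Φ i j').1 ≠ none ∧ st S t Φ (Φ i j').1 ≠ some (Φ i j').2) : v = v' := by
  obtain ⟨j, hj, hv, hrest⟩ := hu
  obtain ⟨j₁, hj₁, hv', -⟩ := hu'
  by_cases hjj : j₁ = j
  · rw [← hj, ← hj₁, hjj]
  · have := (hrest j₁ hjj).1
    rw [hj₁] at this
    exact absurd hv' this

/-- **The unset slot of a unit clause is unique**: any slot holding the unit variable is the unit slot. -/
theorem sissU_unit_slot_unique (S : Finset (Fin m)) (t : ℕ) (Φ : Fin m → Fin k → Fin n × Bool)
    (i : Fin m) (v : Fin n) (j : Fin k) (hv : st S t Φ v = none)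
    (hrest : ∀ j' : Fin k, j' ≠ j → st S t Φ (Φ i j').1 ≠ none ∧ st S t Φ (Φ i j').1 ≠ some (Φ i j').2)
    (j₂ : Fin k) (hj₂ : (Φ i j₂).1 = v) : j₂ = j := by
  by_contra hne
  have := (hrest j₂ hne).1
  rw [hj₂] at this
  exact this hv

include hstep in
/-- **A non-muted clause is unit in at most one round**: if `i ∉ S` is unit (on `v`) at round `t`, then
at every later round all its slots are set, so it is not unit on any variable. -/
theorem sissU_not_unit_later (S : Finset (Fin m)) (t : ℕ) (Φ : Fin m → Fin k → Fin n × Bool)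
    (i : Fin m) (hi : i ∉ S) (v : Fin n)
    (hu : ∃ j : Fin k, (Φ i j).1 = v ∧ st S t Φ v = none ∧ ∀ j' : Fin k, j' ≠ j →
      st S t Φ (Φ i j').1 ≠ none ∧ st S t Φ (Φ i j').1 ≠ some (Φ i j').2)
    (t' : ℕ) (ht' : t < t') (v' : Fin n) :
    ¬ ∃ j : Fin k, (Φ i j).1 = v' ∧ st S t' Φ v' = none ∧ ∀ j' : Fin k, j' ≠ j →
      st S t' Φ (Φ i j').1 ≠ none ∧ st S t' Φ (Φ i j').1 ≠ some (Φ i j').2 := by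
  rintro ⟨j₁, hj₁, hv', -⟩
  obtain ⟨j, hj, hv, hrest⟩ := hu
  -- every slot of `i` is set at round `t + 1`, hence at round `t'`
  have hall : ∀ j₂ : Fin k, st S (t + 1) Φ (Φ i j₂).1 ≠ none := by
    intro j₂
    by_cases hj₂ : j₂ = j
    · rw [hj₂, hj, sissU_st_forced st dm hstep S t Φ v hv ⟨i, hi, j, hj, hrest⟩]
      exact Option.some_ne_none _
    · intro hnone
      exact (hrest j₂ hj₂).1 (sissU_st_none_anti st dm hstep S Φ _ t (t + 1) (Nat.le_succ t) hnone)
  have := sissU_st_none_anti st dm hstep S Φ _ (t + 1) t' ht' (by rw [← hj₁] at hv'; exact hv')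
  exact hall j₁ this

include hstep in
/-- **Unit rounds are unique**: a non-muted clause unit at rounds `t` and `t'` has `t = t'`. -/
theorem sissU_unit_round_unique (S : Finset (Fin m)) (Φ : Fin m → Fin k → Fin n × Bool)
    (i : Fin m) (hi : i ∉ S) (t t' : ℕ) (v v' : Fin n)
    (hu : ∃ j : Fin k, (Φ i j).1 = v ∧ st S t Φ v = none ∧ ∀ j' : Fin k, j' ≠ j →
      st S t Φ (Φ i j').1 ≠ none ∧ st S t Φ (Φ i j').1 ≠ some (Φ i j').2)
    (hu' : ∃ j : Fin k, (Φ i j).1 = v' ∧ st S t' Φ v' = none ∧ ∀ j' : Fin k, j' ≠ j →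
      st S t' Φ (Φ i j').1 ≠ none ∧ st S t' Φ (Φ i j').1 ≠ some (Φ i j').2) : t = t' := by
  by_contra hne
  rcases Nat.lt_or_gt_of_ne hne with hlt | hlt
  · exact sissU_not_unit_later st dm hstep S t Φ i hi v hu t' hlt v' hu'
  · exact sissU_not_unit_later st dm hstep S t' Φ i hi v' hu' t hlt v hu

include h0 in
/-- **No clause is unit at round `0`** (for `k ≥ 2`: another slot would have to be set). -/
theorem sissU_not_unit_zero (hk : 2 ≤ k) (S : Finset (Fin m)) (Φ : Fin m → Fin k → Fin n × Bool)
    (i : Fin m) (v : Fin n) :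
    ¬ ∃ j : Fin k, (Φ i j).1 = v ∧ st S 0 Φ v = none ∧ ∀ j' : Fin k, j' ≠ j →
      st S 0 Φ (Φ i j').1 ≠ none ∧ st S 0 Φ (Φ i j').1 ≠ some (Φ i j').2 := by
  rintro ⟨j, -, -, hrest⟩
  -- a slot different from `j`
  obtain ⟨j', hj'⟩ : ∃ j' : Fin k, j' ≠ j := by
    by_cases hj0 : (j : ℕ) = 0
    · exact ⟨⟨1, by omega⟩, fun h => by rw [Fin.ext_iff] at h; simp at h; omega⟩
    · exact ⟨⟨0, by omega⟩, fun h => by rw [Fin.ext_iff] at h; simp at h; omega⟩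
  exact (hrest j' hj').1 (h0 S Φ _)

end Dynamics

section Main

variable {m k n : ℕ} {R : ℕ}

/-- **Newly unit.** If a non-muted clause `i` is unit at round `t + 1` with unit slot `j`, then some other
slot of `i` was still unset at round `t` (otherwise `i` was already unit at round `t`, its variable was
forced, and `i` would not be unit at round `t + 1`). -/
theorem sissU_unit_succ_new
    (st : Finset (Fin m) → ℕ → (Fin m → Fin k → Fin n × Bool) → Fin n → Option Bool)
    (dm : Finset (Fin m) → ℕ → (Fin m → Fin k → Fin n × Bool) → Fin n → Bool)
    (hstep : ∀ (S : Finset (Fin m)) (t : ℕ) (Φ : Fin m → Fin k → Fin n × Bool) (v : Fin n),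
      st S (t + 1) Φ v =
        if st S t Φ v = none then
          (if ∃ i : Fin m, i ∉ S ∧ ∃ j : Fin k, (Φ i j).1 = v ∧ ∀ j' : Fin k, j' ≠ j →
              st S t Φ (Φ i j').1 ≠ none ∧ st S t Φ (Φ i j').1 ≠ some (Φ i j').2
            then some (dm S t Φ v)
            else if (v : ℕ) * R / n = t then some true else none)
        else st S t Φ v)
    (S : Finset (Fin m)) (t : ℕ) (Φ : Fin m → Fin k → Fin n × Bool)
    (i : Fin m) (hi : i ∉ S) (v : Fin n) (j : Fin k) (hj : (Φ i j).1 = v)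
    (hv : st S (t + 1) Φ v = none)
    (hrest : ∀ j' : Fin k, j' ≠ j →
      st S (t + 1) Φ (Φ i j').1 ≠ none ∧ st S (t + 1) Φ (Φ i j').1 ≠ some (Φ i j').2) :
    ∃ j' : Fin k, j' ≠ j ∧ st S t Φ (Φ i j').1 = none ∧ st S (t + 1) Φ (Φ i j').1 ≠ none := by
  by_contra hno
  have hno' : ∀ j' : Fin k, j' ≠ j → st S t Φ (Φ i j').1 = none → st S (t + 1) Φ (Φ i j').1 = none :=
    fun j' h1 h2 => by_contra fun h3 => hno ⟨j', h1, h2, h3⟩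
  -- then all other slots were set (with the same, false, values) at round `t`: `i` unit at round `t`
  have hrest' : ∀ j' : Fin k, j' ≠ j →
      st S t Φ (Φ i j').1 ≠ none ∧ st S t Φ (Φ i j').1 ≠ some (Φ i j').2 := by
    intro j' hj'
    have hset : st S t Φ (Φ i j').1 ≠ none := fun h => (hrest j' hj').1 (hno' j' hj' h)
    obtain ⟨b, hb⟩ := Option.ne_none_iff_exists'.mp hset
    refine ⟨hset, fun h => ?_⟩
    have hb' := sissU_st_succ_of_eq_some st dm hstep S t Φ _ b hb
    rw [hb] at h
    rw [h] at hb'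
    exact (hrest j' hj').2 hb'
  have hvt : st S t Φ v = none := sissU_st_none_anti st dm hstep S Φ v t (t + 1) (Nat.le_succ t) hv
  have hforced := sissU_st_forced st dm hstep S t Φ v hvt ⟨i, hi, j, hj, hrest'⟩
  rw [hv] at hforced
  exact Option.some_ne_none _ hforced.symm

end Main


end Summit.PneNP.PneNP.Theorems
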